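import Summits.QuantumFields.YangMills.Theorems.ConvexGribovBodyBrascampLiebVacuumSCStubCartanChart
import Summits.QuantumFields.YangMills.Theorems.ConvexGribovBodyCovarianceBoundStubLieAlgPerfect
import Literature.AlgebraicTopology.FundamentalGroup.RotationGroupSO3
import Literature.MathematicalPhysics.QuantumLattice.RepLieAlgebra
import Mathlib.Analysis.InnerProductSpace.PiL2

/-!
# Helpers for the stub `stub_rankOneCentral` of the line `SketchIdeator1` for the crux
# `BrascampLiebVacuumSC` (stmt-QuantumFields-16404, route `ConvexGribovBody`)

Independent tools, assembled in the stub file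
`ConvexGribovBodyBrascampLiebVacuumSCStubRankOneCentral.lean` (where the adjoint homomorphism
`Ad : G → SO(3)` of a compact group with `dim 𝔥 ≤ 3` is built from them):

* `RankOne.exists_hsFrame` — every real subspace `L ⊆ M_N(ℂ)` has an orthonormal frame for the
  Hilbert–Schmidt form `⟨X, Y⟩ = Re tr(X Yᴴ)` indexed by `Fin (finrank L)`, with Parseval expansion;
* `RankOne.pad` — padding a `d × d` real matrix (`d ≤ 3`) by an identity block to a `3 × 3` matrix:
  multiplicative, transpose- and determinant-compatible, injective, continuous;
* `RankOne.rotHom_apply_eq_one_of_mul_self_eq_one` — **the topological core**: a continuous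
  homomorphism `A : G → SO(3)` from a SIMPLY CONNECTED topological group kills every involution.
  Proof (Hatcher, §1.3 path lifting for the universal cover `S³ → SO(3)` of the tree's
  `RotationGroupSO3.lean`): join `1` to `j` by a path `γ`; the loop `γ · (jγ)` at `1` is
  null-homotopic in `G`, so its image `A∘γ · A(j)(A∘γ)` lifts to a LOOP in `S³`; but the lift is
  `Γ · qΓ` (with `Γ` the lift of `A∘γ` from `1`, ending at `q` over `A j`), ending at `q²`; so
  `q² = 1` in the unit quaternions, `q = ±1`, and `A j = rotHom q = 1`;
* `RankOne.hsForm_conj_rho` — `Ad ρ(g)`, `X ↦ ρ(g) X ρ(g⁻¹)`, preserves `Re tr(X Yᴴ)` (`ρ(g)` unitary).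

No named facts are used.
-/

set_option autoImplicit false

noncomputable section

open scoped BigOperators Topology Matrix unitInterval Quaternion
open Set Function
open Literature.MathematicalPhysics.QuantumFieldTheory Literature.MathematicalPhysics.QuantumLattice
open Literature.AlgebraicTopology.FundamentalGroup

namespace Summit.QuantumFields.YangMills.Theorems.BrascampLiebVacuumSC

namespace RankOne

/-! ### Orthonormal frames for the Hilbert–Schmidt form -/

/-- **Orthonormal frame of a real subspace `L ⊆ M_N(ℂ)` for `Re tr(X Yᴴ)`**: vectors
`b₁, …, b_d ∈ L`, `d = dim_ℝ L`, with `⟨bᵢ, bⱼ⟩ = δᵢⱼ` and `X = Σᵢ ⟨bᵢ, X⟩ bᵢ` on `L` (Gram–Schmidt: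
Mathlib's `stdOrthonormalBasis` for the inner product space structure induced on `L`). [folklore] -/
theorem exists_hsFrame {N : ℕ} (L : Submodule ℝ (Matrix (Fin N) (Fin N) ℂ)) :
    ∃ b : Fin (Module.finrank ℝ L) → Matrix (Fin N) (Fin N) ℂ,
      (∀ i, b i ∈ L) ∧ (∀ i j, hsForm N (b i) (b j) = if i = j then 1 else 0) ∧
      ∀ X ∈ L, ∑ i, hsForm N (b i) X • b i = X := by
  letI core : InnerProductSpace.Core ℝ L :=
    { inner := fun x y => hsForm N x y
      conj_inner_symm := fun x y => by
        simp only [RCLike.conj_to_real]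
        exact hsForm_comm _ _
      re_inner_nonneg := fun x => by
        simp only [RCLike.re_to_real]
        exact hsForm_self_nonneg _
      add_left := fun x y z => by
        show hsForm N ((x : Matrix (Fin N) (Fin N) ℂ) + y) z = hsForm N x z + hsForm N y z
        rw [map_add, LinearMap.add_apply]
      smul_left := fun x y c => by
        show hsForm N (c • (x : Matrix (Fin N) (Fin N) ℂ)) y = (starRingEnd ℝ) c * hsForm N x y
        rw [map_smul, LinearMap.smul_apply, RCLike.conj_to_real, smul_eq_mul]
      definite := fun x hx => Subtype.ext (hsForm_self_eq_zero.1 hx) }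
  letI : NormedAddCommGroup L := @InnerProductSpace.Core.toNormedAddCommGroup ℝ L _ _ _ core
  letI : InnerProductSpace ℝ L := InnerProductSpace.ofCore core.toCore
  let e := stdOrthonormalBasis ℝ L
  refine ⟨fun i => (e i : Matrix (Fin N) (Fin N) ℂ), fun i => (e i).2, fun i j => ?_, fun X hX => ?_⟩
  · exact orthonormal_iff_ite.1 e.orthonormal i j
  · have h := congrArg Subtype.val (e.sum_repr' ⟨X, hX⟩)
    rw [Submodule.coe_sum] at h
    exact h

/-! ### The unit quaternions: square roots of `1` -/

/-- In the unit quaternions `S³`, `q² = 1` forces `q = ±1` (`q = q̄` kills the imaginary part).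
[folklore] -/
theorem sphere_eq_one_or_eq_neg_one {q : Metric.sphere (0 : ℍ) 1} (h : q * q = 1) :
    q = 1 ∨ q = -1 := by
  have hq1 : Quaternion.normSq (q : ℍ) = 1 := normSq_coe_sphere q
  have hmul : (q : ℍ) * q = 1 := by
    rw [← Metric.unitSphere.coe_mul, h, Metric.unitSphere.coe_one]
  have hstar : (q : ℍ) * star (q : ℍ) = 1 := by
    rw [Quaternion.self_mul_star, hq1, Quaternion.coe_one]
  have hne : (q : ℍ) ≠ 0 := ne_zero_of_mem_unit_sphere q
  have hsq : star (q : ℍ) = q := mul_left_cancel₀ hne (hstar.trans hmul.symm)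
  have hI : (q : ℍ).imI = 0 := by
    have := congrArg (fun x : ℍ => x.imI) hsq
    simp only [Quaternion.imI_star] at this
    linarith
  have hJ : (q : ℍ).imJ = 0 := by
    have := congrArg (fun x : ℍ => x.imJ) hsq
    simp only [Quaternion.imJ_star] at this
    linarith
  have hK : (q : ℍ).imK = 0 := by
    have := congrArg (fun x : ℍ => x.imK) hsq
    simp only [Quaternion.imK_star] at this
    linarith
  have hre : (q : ℍ).re * (q : ℍ).re = 1 := by
    rw [Quaternion.normSq_def'] at hq1
    nlinarith [hq1, hI, hJ, hK]
  rcases mul_self_eq_one_iff.1 hre with h1 | h1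
  · left
    apply Subtype.ext
    rw [Metric.unitSphere.coe_one]
    ext <;> simp [hI, hJ, hK, h1]
  · right
    apply Subtype.ext
    rw [show ((-1 : Metric.sphere (0 : ℍ) 1) : ℍ) = -1 by simp [Metric.unitSphere.coe_one]]
    ext <;> simp [hI, hJ, hK, h1]

/-! ### The topological core: involutions die in `SO(3)` under maps from simply connected groups -/

/-- Endpoint bookkeeping for lifted concatenations (Mathlib's `IsCoveringMap.liftPath_trans`): if the
lift of `γ₂` from the endpoint of the lift of `γ₁` is `Γ₂`, the lift of `γ₁ · γ₂` ends at `Γ₂ 1`.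
[folklore] -/
theorem liftPath_trans_apply_one_eq {E X : Type*} [TopologicalSpace E] [TopologicalSpace X]
    {p : E → X} (cov : IsCoveringMap p) {x y z : X} {e : E} (hpe : x = p e) (γ₁ : Path x y)
    (γ₂ : Path y z) (Γ₂ : C(I, E))
    (hΓ₂ : ∀ pf, Γ₂ = cov.liftPath γ₂ (cov.liftPath γ₁ e (γ₁.source.trans hpe) 1) pf)
    (pf' : (γ₁.trans γ₂ : C(I, X)) 0 = p e) : cov.liftPath (γ₁.trans γ₂) e pf' 1 = Γ₂ 1 := by
  have key := (DFunLike.congr_fun (cov.liftPath_trans hpe γ₁ γ₂) 1).trans (Path.target _)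
  rw [← hΓ₂] at key
  exact key

/-- **A continuous homomorphism `A : G → SO(3)` from a simply connected topological group maps every
involution to `1`.** Path lifting through the universal cover `rotHom : S³ → SO(3)`: for a path `γ`
from `1` to `j`, the loop `γ · (jγ)` is null-homotopic in `G`, hence so is its image, whose lift
from `1 ∈ S³` is therefore a loop; that lift is `Γ · qΓ` (`Γ` the lift of `A ∘ γ`, `q = Γ(1)` over
`A j`), ending at `q²`; so `q² = 1`, `q = ±1 ∈ ker rotHom`, `A j = rotHom q = 1`. (In `SU(2) = S³`
itself: lifts of half-turns are purely imaginary and square to `−1`.)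
[cite: HatcherAT2002, §1.3 Prop. 1.30–1.31 (path and homotopy lifting) and §3.D (S³ → SO(3))] -/
theorem rotHom_apply_eq_one_of_mul_self_eq_one {G : Type*} [Group G] [TopologicalSpace G]
    [ContinuousMul G] [SimplyConnectedSpace G] (A : G →* SO3) (hA : Continuous A) {j : G}
    (hj : j * j = 1) : A j = 1 := by
  have cov := isCoveringMap_rotHom
  let γ : Path (1 : G) j := PathConnectedSpace.somePath 1 j
  let γ' : Path j 1 := (γ.map (continuous_const_mul j)).cast (mul_one j).symm hj.symm
  -- the image of the loop `γ · γ'` is null-homotopic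
  have hnull : ((γ.map hA).trans (γ'.map hA)).Homotopic ((Path.refl (1 : G)).map hA) := by
    have h := (SimplyConnectedSpace.paths_homotopic (γ.trans γ') (Path.refl 1)).map ⟨A, hA⟩
    rwa [Path.map_trans] at h
  have h1 : A 1 = rotHom 1 := by rw [map_one, map_one]
  have h₀ : (((γ.map hA).trans (γ'.map hA) : Path (A 1) (A 1)) : C(I, SO3)) 0 = rotHom 1 := by
    simp
  have h₁ : (((Path.refl (1 : G)).map hA : Path (A 1) (A 1)) : C(I, SO3)) 0 = rotHom 1 := by
    simp
  have hend := cov.liftPath_apply_one_eq_of_homotopicRel hnull 1 h₀ h₁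
  -- the lift of the constant loop is constant
  have hR : cov.liftPath (((Path.refl (1 : G)).map hA : Path (A 1) (A 1)) : C(I, SO3)) 1 h₁ =
      ContinuousMap.const I 1 := by
    refine ((cov.eq_liftPath_iff' h₁).2 ⟨?_, rfl⟩).symm
    funext t
    simp
  -- the lift `Γ` of `A ∘ γ` from `1`, ending at `q = Γ 1` over `A j`
  have hΓpf : ((γ.map hA : Path (A 1) (A j)) : C(I, SO3)) 0 = rotHom 1 := by simp [h1]
  set Γ : C(I, Metric.sphere (0 : ℍ) 1) :=
    cov.liftPath ((γ.map hA : Path (A 1) (A j)) : C(I, SO3)) 1 hΓpf with hΓ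
  have hΓt : ∀ t, rotHom (Γ t) = A (γ t) := fun t => by
    simpa using congr_fun (cov.liftPath_lifts ((γ.map hA : Path (A 1) (A j)) : C(I, SO3)) 1 hΓpf) t
  have hΓ0 : Γ 0 = 1 := cov.liftPath_zero _ _ _
  have hq : rotHom (Γ 1) = A j := by rw [hΓt 1]; simp
  -- the lift of `A ∘ γ'` from `q` is `q • Γ`
  have hlift2 : ∀ pf, cov.liftPath ((γ'.map hA : Path (A j) (A 1)) : C(I, SO3)) (Γ 1) pf =
      ⟨fun t => Γ 1 * Γ t, by fun_prop⟩ := by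
    intro pf
    refine ((cov.eq_liftPath_iff' pf).2 ⟨?_, ?_⟩).symm
    · funext t
      show rotHom (Γ 1 * Γ t) = A (j * γ t)
      rw [map_mul, map_mul, hq, hΓt]
    · show Γ 1 * Γ 0 = Γ 1
      rw [hΓ0, mul_one]
  -- the lift of the whole loop ends at `q²`, and is a loop
  have hL : cov.liftPath (((γ.map hA).trans (γ'.map hA) : Path (A 1) (A 1)) : C(I, SO3)) 1 h₀ 1 =
      Γ 1 * Γ 1 :=
    liftPath_trans_apply_one_eq cov h1 (γ.map hA) (γ'.map hA) ⟨fun t => Γ 1 * Γ t, by fun_prop⟩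
      (fun pf => (hlift2 pf).symm) h₀
  have hqq : Γ 1 * Γ 1 = 1 := by
    rw [← hL]
    exact hend.trans (DFunLike.congr_fun hR 1)
  have hk : Γ 1 ∈ rotHom.ker := (mem_ker_rotHom_iff _).2 (sphere_eq_one_or_eq_neg_one hqq)
  rw [← hq]
  exact hk

/-! ### Padding `d × d` matrices (`d ≤ 3`) to `3 × 3` by an identity block -/

/-- **Padding by an identity block**: for `d ≤ 3` there is a monoid homomorphism
`P : M_d(ℝ) → M_3(ℝ)`, `B ↦ diag(B, 1)` (reindexed along `Fin d ⊕ Fin (3 − d) ≃ Fin 3`), which is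
continuous, injective, and commutes with transposition and the determinant. [folklore] -/
theorem exists_pad {d : ℕ} (hd : d ≤ 3) :
    ∃ P : Matrix (Fin d) (Fin d) ℝ →* Matrix (Fin 3) (Fin 3) ℝ,
      Continuous P ∧ Function.Injective P ∧ (∀ B, (P B)ᵀ = P Bᵀ) ∧ ∀ B, (P B).det = B.det := by
  obtain ⟨e⟩ : Nonempty (Fin d ⊕ Fin (3 - d) ≃ Fin 3) := ⟨finSumFinEquiv.trans (finCongr (by omega))⟩
  set F : Matrix (Fin d) (Fin d) ℝ → Matrix (Fin 3) (Fin 3) ℝ := fun B =>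
    Matrix.reindexAlgEquiv ℝ ℝ e (Matrix.fromBlocks B 0 0 1) with hF
  have hF1 : F 1 = 1 := by
    simp only [hF]
    rw [Matrix.fromBlocks_one, map_one]
  have hFmul : ∀ B C, F (B * C) = F B * F C := fun B C => by
    simp only [hF]
    rw [← map_mul, Matrix.fromBlocks_multiply]
    simp
  refine ⟨{ toFun := F, map_one' := hF1, map_mul' := hFmul }, ?_, ?_, ?_, ?_⟩
  · show Continuous F
    simp only [hF, Matrix.coe_reindexAlgEquiv]
    exact (continuous_id.matrix_fromBlocks continuous_const continuous_const
      continuous_const).matrix_reindex _ _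
  · intro B C h
    have h' : F B = F C := h
    simp only [hF] at h'
    exact (Matrix.fromBlocks_inj.1 ((Matrix.reindexAlgEquiv ℝ ℝ e).injective h')).1
  · intro B
    show (F B)ᵀ = F Bᵀ
    simp [hF, Matrix.fromBlocks_transpose]
  · intro B
    show (F B).det = B.det
    simp [hF]

/-! ### Unitary conjugation and the Hilbert–Schmidt form -/

variable {G : Type} [Group G] [TopologicalSpace G]

/-- `ρ(g⁻¹) = ρ(g)ᴴ` for a unitary representation. [folklore] -/
theorem rho_inv_eq_star (r : LatticeRep G) (g : G) : r.ρ g⁻¹ = star (r.ρ g) := by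
  have h1 : r.ρ g⁻¹ * r.ρ g = 1 := by rw [← map_mul, inv_mul_cancel, map_one]
  have h2 : r.ρ g * star (r.ρ g) = 1 := Matrix.mem_unitaryGroup_iff.1 (r.mem_unitary g)
  calc r.ρ g⁻¹ = r.ρ g⁻¹ * (r.ρ g * star (r.ρ g)) := by rw [h2, mul_one]
    _ = star (r.ρ g) := by rw [← mul_assoc, h1, one_mul]

/-- `ρ(g)ᴴ ρ(g) = 1`. [folklore] -/
theorem star_rho_mul_rho (r : LatticeRep G) (g : G) : star (r.ρ g) * r.ρ g = 1 :=
  Matrix.mem_unitaryGroup_iff'.1 (r.mem_unitary g)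

/-- **`Ad`-invariance of the Hilbert–Schmidt form**: `⟨U X Uᴴ, U Y Uᴴ⟩ = ⟨X, Y⟩` for `Uᴴ U = 1`
(cyclicity of the trace). [cite: Sepanski2007, Thm. 5.18] -/
theorem hsForm_conj {N : ℕ} (U X Y : Matrix (Fin N) (Fin N) ℂ) (hU : star U * U = 1) :
    hsForm N (U * X * star U) (U * Y * star U) = hsForm N X Y := by
  have hU' : Uᴴ * U = 1 := hU
  simp only [hsForm_apply, Matrix.star_eq_conjTranspose, Matrix.conjTranspose_mul,
    Matrix.conjTranspose_conjTranspose]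
  have : U * X * Uᴴ * (U * (Yᴴ * Uᴴ)) = U * (X * Yᴴ * Uᴴ) := by
    calc U * X * Uᴴ * (U * (Yᴴ * Uᴴ)) = U * X * (Uᴴ * U) * (Yᴴ * Uᴴ) := by
          simp only [Matrix.mul_assoc]
      _ = U * (X * Yᴴ * Uᴴ) := by rw [hU', Matrix.mul_one]; simp only [Matrix.mul_assoc]
  rw [this, Matrix.trace_mul_comm, Matrix.mul_assoc, hU', Matrix.mul_one]

/-- `Ad ρ(g)` on `M_N(ℂ)`: `X ↦ ρ(g) X ρ(g⁻¹)` preserves the Hilbert–Schmidt form. [cite: Sepanski2007, Thm. 5.18] -/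
theorem hsForm_conj_rho (r : LatticeRep G) (g : G) (X Y : Matrix (Fin r.N) (Fin r.N) ℂ) :
    hsForm r.N (r.ρ g * X * r.ρ g⁻¹) (r.ρ g * Y * r.ρ g⁻¹) = hsForm r.N X Y := by
  rw [rho_inv_eq_star]
  exact hsForm_conj _ _ _ (star_rho_mul_rho r g)

end RankOne

/-- **Registered sub-goal `stub_rankOneTopCore` of `stub_rankOneCentral`** (the topological core
`RankOne.rotHom_apply_eq_one_of_mul_self_eq_one` in closed form): a continuous homomorphism from a
simply connected topological group to `SO(3)` maps every involution to `1` (path lifting through the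
universal cover `S³ → SO(3)`). [cite: HatcherAT2002, §1.3 and §3.D] -/
theorem stub_rankOneTopCore :
    ∀ (G : Type) [Group G] [TopologicalSpace G] [IsTopologicalGroup G], SimplyConnectedSpace G →
      ∀ (A : G →* Literature.AlgebraicTopology.FundamentalGroup.SO3), Continuous A →
        ∀ j : G, j * j = 1 → A j = 1 :=
  fun _G _ _ _ _ A hA _j hj => RankOne.rotHom_apply_eq_one_of_mul_self_eq_one A hA hj

end Summit.QuantumFields.YangMills.Theorems.BrascampLiebVacuumSC

end
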